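import Literature.Probability.LatticeModels.CellDomain

/-!
# Cell domains have a hole at every face centre

Topic `Literature/Probability/LatticeModels`; companion (negative knowledge) to `CellDomain.lean`
(definition item `defn-CellDomain`, route SAWSchrammPassage of
`Summits/CriticalPhenomena/SAWScalingLimit`, items `stmt-CriticalPhenomena-5595/5596`, found
vacuous by the refuter route review of 2026-08-15 for exactly this reason).

For `δ > 0`, NO corner-cut cell `cutCell δ v` contains a face centre
`meshPoint δ f + δ(1+i)/2`: its ℓ¹-distance to every mesh point is `≥ δ > 9δ/10`. Hence, for
every finite `S`, the cell domain `CellDomain S δ = interior (⋃ v ∈ S, cutCell δ v)` omits the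
open diamond of ℓ¹-radius `δ/10` around every point of `δ(ℤ+½)²`; in particular
`infDist z (CellDomain S δ)ᶜ < δ` for every `z`, no closed ball of radius `≥ δ/√2` fits inside,
and `CellDomain S δ` is NOT simply connected (not a Jordan domain) as soon as `S` contains a
`2 × 2` block — contrary to the intended API ("when simply connected it is a Jordan domain").
-/

noncomputable section

open Metric

namespace Literature.Probability.LatticeModels

/-- **No corner-cut cell contains a face centre** (`δ > 0`): the ℓ¹-distance from a face centre
to every mesh point is `≥ δ > 9δ/10`. [folklore] -/
theorem faceCentre_not_mem_cutCell {δ : ℝ} (hδ : 0 < δ) (f v : Site 2) :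
    (meshPoint δ f + ((δ / 2 : ℝ) : ℂ) * (1 + Complex.I)) ∉ cutCell δ v := by
  rintro ⟨-, -, h3⟩
  have hre : ((meshPoint δ f + ((δ / 2 : ℝ) : ℂ) * (1 + Complex.I))).re - (meshPoint δ v).re = δ * (((f 0 - v 0 : ℤ) : ℝ) + 1 / 2) := by
    simp [meshPoint_re]
    ring
  have him : ((meshPoint δ f + ((δ / 2 : ℝ) : ℂ) * (1 + Complex.I))).im - (meshPoint δ v).im = δ * (((f 1 - v 1 : ℤ) : ℝ) + 1 / 2) := by
    simp [meshPoint_im]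
    ring
  have key : ∀ k : ℤ, δ / 2 ≤ |δ * ((k : ℝ) + 1 / 2)| := by
    intro k
    rw [abs_mul, abs_of_pos hδ]
    have hk : (1 / 2 : ℝ) ≤ |(k : ℝ) + 1 / 2| := by
      rcases le_or_gt 0 k with hk | hk
      · have hk' : (0 : ℝ) ≤ k := by exact_mod_cast hk
        rw [abs_of_nonneg (by linarith)]
        linarith
      · have hk' : (k : ℝ) ≤ -1 := by
          have : k ≤ -1 := by omega
          exact_mod_cast this
        rw [abs_of_neg (by linarith)]
        linarith
    nlinarith
  rw [hre, him] at h3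
  have h0 := key (f 0 - v 0)
  have h1 := key (f 1 - v 1)
  push_cast at h0 h1 h3
  linarith

/-- Face centres never lie in a cell domain, whatever `S` is (`δ > 0`). [folklore] -/
theorem faceCentre_not_mem_cellDomain {δ : ℝ} (hδ : 0 < δ) (S : Finset (Site 2)) (f : Site 2) :
    (meshPoint δ f + ((δ / 2 : ℝ) : ℂ) * (1 + Complex.I)) ∉ CellDomain S δ := by
  intro h
  obtain ⟨v, -, hv⟩ := exists_mem_cutCell_of_mem_cellDomain h
  exact faceCentre_not_mem_cutCell hδ f v hv

/-- Every point of the plane is within distance `< δ` (indeed `≤ δ/√2`) of a face centre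
(`δ > 0`). [folklore] -/
theorem exists_dist_faceCentre_lt {δ : ℝ} (hδ : 0 < δ) (z : ℂ) :
    ∃ f : Site 2, dist z ((meshPoint δ f + ((δ / 2 : ℝ) : ℂ) * (1 + Complex.I))) < δ := by
  refine ⟨![round (z.re / δ - 1 / 2), round (z.im / δ - 1 / 2)], ?_⟩
  set c : ℂ := meshPoint δ ![round (z.re / δ - 1 / 2), round (z.im / δ - 1 / 2)] +
    ((δ / 2 : ℝ) : ℂ) * (1 + Complex.I) with hc
  have hδ0 : δ ≠ 0 := hδ.ne'
  have hre : (z - c).re = δ * ((z.re / δ - 1 / 2) - round (z.re / δ - 1 / 2)) := by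
    simp [hc, meshPoint_re]
    field_simp
    ring
  have him : (z - c).im = δ * ((z.im / δ - 1 / 2) - round (z.im / δ - 1 / 2)) := by
    simp [hc, meshPoint_im]
    field_simp
    ring
  have h1 : |(z - c).re| ≤ δ / 2 := by
    rw [hre, abs_mul, abs_of_pos hδ]
    have := abs_sub_round (z.re / δ - 1 / 2)
    nlinarith
  have h2 : |(z - c).im| ≤ δ / 2 := by
    rw [him, abs_mul, abs_of_pos hδ]
    have := abs_sub_round (z.im / δ - 1 / 2)
    nlinarith
  have hsq : ‖z - c‖ ^ 2 < δ ^ 2 := by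
    rw [Complex.sq_norm, Complex.normSq_apply]
    obtain ⟨a1, a2⟩ := abs_le.mp h1
    obtain ⟨b1, b2⟩ := abs_le.mp h2
    nlinarith
  rw [Complex.dist_eq]
  exact lt_of_pow_lt_pow_left₀ 2 hδ.le hsq

/-- **No point of a cell domain has a full lattice spacing of room**: for `δ > 0` and every `z`,
`infDist z (CellDomain S δ)ᶜ < δ`. In particular the hypothesis `N δ ≤ infDist z (CellDomain S δ)ᶜ`
with `N ≥ 1` (route SAWSchrammPassage, `SchrammPassageUniform`) is unsatisfiable. [folklore] -/
theorem infDist_compl_cellDomain_lt {δ : ℝ} (hδ : 0 < δ) (S : Finset (Site 2)) (z : ℂ) :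
    infDist z (CellDomain S δ)ᶜ < δ := by
  obtain ⟨f, hf⟩ := exists_dist_faceCentre_lt hδ z
  exact (infDist_le_dist_of_mem (faceCentre_not_mem_cellDomain hδ S f)).trans_lt hf

/-- No closed ball of radius `≥ δ` lies in a cell domain (`δ > 0`); so a hypothesis
`cthickening r K ⊆ CellDomain S δ` with `K` nonempty and `δ ≤ r` (route SAWSchrammPassage,
`TurningClosure`) is unsatisfiable. [folklore] -/
theorem not_closedBall_subset_cellDomain {δ r : ℝ} (hδ : 0 < δ) (hr : δ ≤ r)
    (S : Finset (Site 2)) (z : ℂ) : ¬ closedBall z r ⊆ CellDomain S δ := by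
  intro h
  obtain ⟨f, hf⟩ := exists_dist_faceCentre_lt hδ z
  have hmem : (meshPoint δ f + ((δ / 2 : ℝ) : ℂ) * (1 + Complex.I)) ∈ closedBall z r := by
    rw [mem_closedBall, dist_comm]; linarith
  exact faceCentre_not_mem_cellDomain hδ S f (h hmem)

end Literature.Probability.LatticeModels

end
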